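import Summits.ResolutionOfSingularities.ResolutionOfSingularities.Theorems.PurelyInseparableDim4PointZigzagStep
import Mathlib.Logic.Hydra
import HarnessLib

/-!
# Purely inseparable four-folds: TERMINATION OF THE POINT-CENTRE WALK ⇒ ORDER REDUCTION in the ISOLATED regime —
# the FINITE TREE of closed order-`p` points (brick TY-3k part 3 «POINT TREE», cell `res-dim4-pi`)

[OURS · counted 0] (D-0157 DOOR 2; the finite-tree assembly of `PIDim4.TerminationImpliesOrderReduction` for MODE 0
(point centres) with SEVERAL isolated closed order-`p` points per stage (typ-3 memo §D (d3)–(d4)); host item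
stmt-ResolutionOfSingularities-16155, helper). Resolution of singularities in dimension ≥ 4 / characteristic `p` is NOT
proved here or anywhere in this programme.

A CONFIGURATION at an admissible prefix `IsMultipleBlowup M₀ σ M′` is a finite set `pts` of closed points of `X′`
containing every closed point of order `≥ p` of `M′`, each `x ∈ pts` carrying a state `st x` (`F ≠ 0` clean,
`p ≤ ord₀ F`) with a ZIGZAG chart (`…PointZigzag`) and a well-founded walk below it (`Acc (Edge p univ)ᵒᵖ (st x)`).
One step: blow up ONE point `x₁ ∈ pts`; the other points keep their states and their (shrunk) zigzag charts
(`exists_zigzag_comap_controlledTransform_of_not_mem_support`), the finitely many closed order-`p` points over `x₁` get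
EDGE successors of `st x₁` with zigzag charts (`zigzag_step_package`). The multiset of states therefore moves DOWN in
the Dershowitz–Manna order generated by the edge relation — Mathlib's hydra relation `Relation.CutExpand`.

* `not_edge_self_of_acc` — a state below which the walk is well-founded is not its own successor;
* **`exists_isMarkedResolution_of_config`** — the induction on `Acc (CutExpand _)` of the multiset of states: every
  configuration (geometric side: the ISOLATED regime `hfin` — along every admissible sequence the closed points of
  order `≥ p` are finitely many) leads to a marked resolution of `M₀`;
* **`exists_isMarkedResolution_of_acc_of_finite`** — the root case over `𝔸⁵_K`: `K = K̄`, `F ≠ 0` clean with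
  `p ≤ ord₀ F`, the origin the only closed order-`p` point of `(z^p + F)·𝒪`, `Acc (Edge p univ)ᵒᵖ (F, 0, ∅)` and the
  isolated regime ⇒ `∃ X′ π M′, IsMarkedResolution ⟨hypSheaf p F, [], p⟩ π M′` — the conclusion of
  `PIDim4.OrderReduction p` for this `F`; it subsumes the single-point chain `exists_isMarkedResolution_of_acc_root`
  (whose hypothesis «at most one closed order-`p` point at every stage» is the case `|pts| ≤ 1`).

NOT `OrderReduction p` (positive-dimensional order-`p` loci and non-isolated points are outside this regime).
AI-produced formalisation, weaker than expert review. bears_on: LADDER-RESOLUTION:D157-DOOR2 (res-dim4-pi · TY-3k).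
-/

set_option linter.dupNamespace false -- D-0017: single-problem summit path `Summit.<S>.<S>.…` by design

noncomputable section

open MvPolynomial Finset CategoryTheory AlgebraicGeometry Opposite TopologicalSpace

namespace Summit.ResolutionOfSingularities.ResolutionOfSingularities.Theorems.PIDim4

open Literature.AlgebraicGeometry.Resolution
open Literature.AlgebraicGeometry.Resolution.Hauser2010
open Literature.AlgebraicGeometry.Resolution.AffinePointBlowup (P A γ coord Wtop ξ)

namespace Equimultiple

section Tree

variable {K : Type} [Field K] {p : ℕ} [hp : Fact p.Prime] [CharP K p]

omit hp [CharP K p] in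
/-- A state below which the point-centre walk is well-founded is not its own edge successor. [folklore] -/
theorem not_edge_self_of_acc [DecidableEq K] {s : State K} (h : Acc (fun s' s : State K => Edge p Finset.univ s s') s) :
    ¬ Edge p Finset.univ s s := by
  induction h with
  | intro s _ ih => exact fun he => ih s he he

/-- **THE FINITE TREE (induction on the multiset of states).** `M₀` a marked ideal on a locally Noetherian Jacobson
`X` with snc boundary and `mult M₀ = p`, `K = K̄` of characteristic `p`, in the ISOLATED regime: along every admissible
sequence `IsMultipleBlowup M₀ σ M′` the closed points of order `≥ p` of `M′` are finitely many. Then every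
CONFIGURATION (module docstring) at an admissible prefix whose multiset of states is accessible for the hydra relation
`CutExpand` of «edge successor, different state» leads to a marked resolution of `M₀`: blow up one point of the
configuration, re-chart the survivors and the new order-`p` points over it, recurse.
[cite: BierstoneGrigorievMilmanWlodarczyk2011, Def. 3.1.3] [cite: Hauser2010, §F]
[cite: Hironaka1964, Main Theorem I (the characteristic-zero statement whose analogue is asked)] -/
theorem exists_isMarkedResolution_of_config {X : Scheme.{0}} [IsLocallyNoetherian X] [JacobsonSpace X]
    [IsAlgClosed K] [DecidableEq K] (M₀ : MarkedIdeal X) (hE : HasSNC M₀.boundary) (hmult : M₀.mult = p)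
    (hfin : ∀ (X' : Scheme.{0}) (σ : X' ⟶ X) (M' : MarkedIdeal X'), IsMultipleBlowup M₀ σ M' →
      {w : X' | IsClosed ({w} : Set X') ∧ (p : ℕ∞) ≤ idealOrder M'.ideal w}.Finite)
    (T : Multiset (State K))
    (hT : Acc (Relation.CutExpand (fun s' s : State K => Edge p Finset.univ s s' ∧ s' ≠ s)) T) :
    ∀ (X' : Scheme.{0}) (σ : X' ⟶ X) (M' : MarkedIdeal X') (_ : IsMultipleBlowup M₀ σ M') (pts : Finset X')
      (st : X' → State K) (_ : pts.val.map st = T) (_ : ∀ x ∈ pts, IsClosed ({x} : Set X'))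
      (_ : ∀ z : X', IsClosed ({z} : Set X') → (p : ℕ∞) ≤ idealOrder M'.ideal z → z ∈ pts)
      (_ : ∀ x ∈ pts, (st x).F ≠ 0 ∧
        Literature.Barriers.ResolutionOfSingularities.HauserPerlega.IsClean p (st x).F ∧
        (p : ℕ∞) ≤ CentreBlowup.ordAlong (Finset.univ : Finset (Fin 4)) (st x).F ∧
        Acc (fun s' s : State K => Edge p Finset.univ s s') (st x) ∧
        ∃ (Y : Scheme.{0}) (φ : Y ⟶ X') (ψ : Y ⟶ P 4 K) (_ : IsOpenImmersion φ) (_ : IsOpenImmersion ψ) (y : Y),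
          φ y = x ∧ ψ y = ξ 4 K ∧ M'.ideal.comap φ = (hypSheaf p (st x).F).comap ψ),
      ∃ (X'' : Scheme.{0}) (π : X'' ⟶ X) (M'' : MarkedIdeal X''), IsMarkedResolution M₀ π M'' := by
  classical
  induction hT with
  | intro T _ ih =>
    intro X' σ M' h pts st hT hclosed hcover hdata
    haveI : IsLocallyNoetherian X' := h.isLocallyNoetherian
    haveI : JacobsonSpace X' := jacobsonSpace_of_isMultipleBlowup h
    have hmult' : M'.mult = p := h.mult_eq.trans hmult
    rcases pts.eq_empty_or_nonempty with hempty | ⟨x₁, hx₁⟩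
    · -- no closed point of order `≥ p`: the prefix is already a marked resolution
      have hreg : Scheme.IsRegular X' := fun x => ((h.hasSNC_boundary hE) x).1
      refine ⟨X', σ, M', h, (support_eq_empty_iff_forall_isClosed hreg M').mpr fun w hw => ?_⟩
      rw [hmult']
      by_contra hge
      rw [not_lt] at hge
      have hmem := hcover w hw hge
      rw [hempty] at hmem
      exact Finset.notMem_empty w hmem
    · -- blow up `x₁`
      obtain ⟨hF₁, hclean₁, hperm₁, hacc₁, Y, φ, ψ, _, _, y, hφ, hψ, hM₁⟩ := hdata x₁ hx₁
      have hx₁c : IsClosed ({x₁} : Set X') := hclosed x₁ hx₁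
      set s₁ : State K := st x₁ with hs₁
      set C := Scheme.IdealSheafData.vanishingIdeal (⟨{x₁}, hx₁c⟩ : Closeds X') with hC
      have hπ : IsBlowup (blowup.π C) C := blowup.isBlowup C
      have h₁ : IsMultipleBlowup M₀ (blowup.π C ≫ σ) (M'.transform (blowup.π C) C) :=
        isMultipleBlowup_extend_point_of_zigzag h hE hmult φ ψ y hx₁c hφ hψ s₁ hM₁ hperm₁ hπ
      haveI : IsLocallyNoetherian (blowup C) := h₁.isLocallyNoetherian
      set M'' := M'.transform (blowup.π C) C with hM''
      have hM''I : M''.ideal = controlledTransform (blowup.π C) C M'.ideal M'.mult := rfl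
      -- membership in the centre's support
      have hsuppC : ∀ z : X', z ∉ (C.support : Set X') ↔ z ≠ x₁ := fun z =>
        not_congr (mem_support_vanishingIdeal_singleton_iff hx₁c)
      -- the step package at the closed order-`p` points over `x₁`
      have pkg : ∀ w : blowup C, IsClosed ({w} : Set (blowup C)) → blowup.π C w = x₁ →
          (p : ℕ∞) ≤ idealOrder M''.ideal w →
          ∃ (j : Fin 4) (b : Fin 4 → K), b j = 0 ∧ Edge p Finset.univ s₁ (CentreBlowup.step p Finset.univ j b s₁) ∧
            ∃ (Y' : Scheme.{0}) (φ' : Y' ⟶ blowup C) (ψ' : Y' ⟶ P 4 K) (_ : IsOpenImmersion φ')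
              (_ : IsOpenImmersion ψ') (y' : Y'), φ' y' = w ∧ ψ' y' = ξ 4 K ∧
              M''.ideal.comap φ' = (hypSheaf p (CentreBlowup.step p Finset.univ j b s₁).F).comap ψ' :=
        fun w hw hwx hord =>
          zigzag_step_package φ ψ y hx₁c hφ hψ M' hmult' s₁ hM₁ hF₁ hclean₁ hperm₁ hπ hw hwx hord
      -- the new configuration: all closed order-`p` points upstairs (finitely many: isolated regime)
      set pts' : Finset (blowup C) := (hfin _ _ _ h₁).toFinset with hpts'
      have hmem' : ∀ w : blowup C, w ∈ pts' ↔ IsClosed ({w} : Set (blowup C)) ∧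
          (p : ℕ∞) ≤ idealOrder M''.ideal w := fun w => by
        rw [hpts', Set.Finite.mem_toFinset, Set.mem_setOf_eq]
      -- the new states: edge successors over `x₁`, the old states elsewhere
      set st' : blowup C → State K := fun w =>
        if hc : IsClosed ({w} : Set (blowup C)) ∧ blowup.π C w = x₁ ∧ (p : ℕ∞) ≤ idealOrder M''.ideal w then
          CentreBlowup.step p Finset.univ (pkg w hc.1 hc.2.1 hc.2.2).choose
            (pkg w hc.1 hc.2.1 hc.2.2).choose_spec.choose s₁
        else st (blowup.π C w) with hst'
      -- over `x₁`: the chosen edge successor and its zigzag chart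
      have hover : ∀ w ∈ pts', blowup.π C w = x₁ →
          ∃ (j : Fin 4) (b : Fin 4 → K), st' w = CentreBlowup.step p Finset.univ j b s₁ ∧ b j = 0 ∧
            Edge p Finset.univ s₁ (CentreBlowup.step p Finset.univ j b s₁) ∧
            ∃ (Y' : Scheme.{0}) (φ' : Y' ⟶ blowup C) (ψ' : Y' ⟶ P 4 K) (_ : IsOpenImmersion φ')
              (_ : IsOpenImmersion ψ') (y' : Y'), φ' y' = w ∧ ψ' y' = ξ 4 K ∧
              M''.ideal.comap φ' = (hypSheaf p (CentreBlowup.step p Finset.univ j b s₁).F).comap ψ' := by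
        intro w hw hwx
        obtain ⟨hwc, hord⟩ := (hmem' w).mp hw
        have hc : IsClosed ({w} : Set (blowup C)) ∧ blowup.π C w = x₁ ∧ (p : ℕ∞) ≤ idealOrder M''.ideal w :=
          ⟨hwc, hwx, hord⟩
        refine ⟨(pkg w hc.1 hc.2.1 hc.2.2).choose, (pkg w hc.1 hc.2.1 hc.2.2).choose_spec.choose, ?_,
          (pkg w hc.1 hc.2.1 hc.2.2).choose_spec.choose_spec⟩
        rw [hst']
        exact dif_pos hc
      -- elsewhere: the old state of the image point
      have hoff : ∀ w : blowup C, blowup.π C w ≠ x₁ → st' w = st (blowup.π C w) := by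
        intro w hwx
        rw [hst']
        exact dif_neg fun hc => hwx hc.2.1
      -- image points of the survivors are old configuration points
      have himg : ∀ w ∈ pts', blowup.π C w ≠ x₁ → blowup.π C w ∈ pts ∧
          idealOrder M''.ideal w = idealOrder M'.ideal (blowup.π C w) := by
        intro w hw hwx
        obtain ⟨hwc, hord⟩ := (hmem' w).mp hw
        have hnot : blowup.π C w ∉ (C.support : Set X') := (hsuppC _).mpr hwx
        have hordeq : idealOrder M''.ideal w = idealOrder M'.ideal (blowup.π C w) := by
          rw [hM''I]
          exact idealOrder_controlledTransform_eq_of_eq_of_not_mem_support hπ hnot M'.ideal M'.mult rfl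
        refine ⟨hcover _ (isClosed_singleton_π' hπ hwc) ?_, hordeq⟩
        rw [← hordeq]
        exact hord
      -- every old point other than `x₁` has exactly one preimage, and it is a new configuration point
      have hpre : ∀ z ∈ pts, z ≠ x₁ → ∃ w ∈ pts', blowup.π C w = z := by
        intro z hz hzx
        have hnot : z ∉ (C.support : Set X') := (hsuppC z).mpr hzx
        obtain ⟨w, hw⟩ := exists_eq_of_not_mem_support hπ hnot
        obtain ⟨-, -, hpermz, -, Yz, φz, ψz, _, _, yz, hφz, hψz, hMz⟩ := hdata z hz
        refine ⟨w, (hmem' w).mpr ⟨?_, ?_⟩, hw⟩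
        · refine isClosed_singleton_of_not_mem_support hπ ?_ (by rw [hw]; exact hnot)
          rw [hw]
          exact hclosed z hz
        · rw [hM''I, idealOrder_controlledTransform_eq_of_eq_of_not_mem_support hπ hnot M'.ideal M'.mult hw]
          exact le_idealOrder_of_zigzag φz ψz yz hφz hψz M' (st z) hMz hpermz
      have hinj : Set.InjOn (fun w => blowup.π C w) ↑(pts'.filter fun w => blowup.π C w ≠ x₁) := by
        intro w hw w' hw' he
        rw [Finset.coe_filter, Set.mem_setOf_eq] at hw
        exact eq_of_eq_of_not_mem_support hπ he ((hsuppC _).mpr hw.2)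
      -- multiset bookkeeping: the survivors carry the old multiset minus `s₁`
      have himage : (pts'.filter fun w => blowup.π C w ≠ x₁).image (fun w => blowup.π C w) = pts.erase x₁ := by
        ext z
        simp only [Finset.mem_image, Finset.mem_filter, Finset.mem_erase]
        constructor
        · rintro ⟨w, ⟨hw, hwx⟩, rfl⟩
          exact ⟨hwx, (himg w hw hwx).1⟩
        · rintro ⟨hzx, hz⟩
          obtain ⟨w, hw, hwz⟩ := hpre z hz hzx
          exact ⟨w, ⟨hw, by rw [hwz]; exact hzx⟩, hwz⟩
      have hrest : ((pts'.filter fun w => blowup.π C w ≠ x₁).val).map st' = ((pts.erase x₁).val).map st := by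
        rw [← himage, Finset.image_val_of_injOn hinj, Multiset.map_map]
        refine Multiset.map_congr rfl fun w hw => ?_
        rw [Finset.mem_val, Finset.mem_filter] at hw
        exact hoff w hw.2
      have hTsplit : T = s₁ ::ₘ ((pts.erase x₁).val).map st := by
        rw [← hT, ← Multiset.map_cons st x₁, Finset.erase_val, Multiset.cons_erase (Finset.mem_val.mpr hx₁)]
      have hT'split : pts'.val.map st' = ((pts'.filter fun w => blowup.π C w = x₁).val).map st' +
          ((pts.erase x₁).val).map st := by
        rw [← hrest, ← Multiset.map_add, Finset.filter_val, Finset.filter_val, Multiset.filter_add_not]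
      -- the hydra move
      have hcut : Relation.CutExpand (fun s' s : State K => Edge p Finset.univ s s' ∧ s' ≠ s)
          (pts'.val.map st') T := by
        refine ⟨((pts'.filter fun w => blowup.π C w = x₁).val).map st', s₁, fun a ha => ?_, ?_⟩
        · rw [Multiset.mem_map] at ha
          obtain ⟨w, hw, rfl⟩ := ha
          rw [Finset.mem_val, Finset.mem_filter] at hw
          obtain ⟨j, b, hst'w, -, hedge, -⟩ := hover w hw.1 hw.2
          rw [hst'w]
          exact ⟨hedge, fun he => not_edge_self_of_acc hacc₁ (by rw [he] at hedge; exact hedge)⟩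
        · rw [hT'split, hTsplit, ← Multiset.singleton_add]
          abel
      -- recurse on the new configuration
      refine ih _ hcut (blowup C) (blowup.π C ≫ σ) M'' h₁ pts' st' rfl (fun w hw => ((hmem' w).mp hw).1)
        (fun z hz hzo => (hmem' z).mpr ⟨hz, hzo⟩) fun w hw => ?_
      by_cases hwx : blowup.π C w = x₁
      · obtain ⟨j, b, hst'w, -, hedge, Y', φ', ψ', _, _, y', hφ', hψ', hM'⟩ := hover w hw hwx
        obtain ⟨j'', b'', -, -, heq'', hF'', hs''⟩ := id hedge
        rw [hst'w]
        refine ⟨by rw [hs'']; exact hF'', isClean_step Finset.univ j b s₁,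
          by rw [hs'']; exact ordAlong_univ_step_of_isEquimultiplePoint j'' b'' s₁ heq'', hacc₁.inv hedge,
          Y', φ', ψ', inferInstance, inferInstance, y', hφ', hψ', hM'⟩
      · obtain ⟨hz, -⟩ := himg w hw hwx
        obtain ⟨hFz, hcleanz, hpermz, haccz, Yz, φz, ψz, _, _, yz, hφz, hψz, hMz⟩ := hdata _ hz
        have hnot : blowup.π C w ∉ (C.support : Set X') := (hsuppC _).mpr hwx
        obtain ⟨Y', φ', ψ', _, _, y', hφ', hψ', hM'⟩ :=
          exists_zigzag_comap_controlledTransform_of_not_mem_support hπ hnot φz ψz yz hφz hψz M'.ideal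
            (hypSheaf p (st (blowup.π C w)).F) hMz M'.mult (w := w) rfl
        rw [hoff w hwx]
        exact ⟨hFz, hcleanz, hpermz, haccz, Y', φ', ψ', inferInstance, inferInstance, y', hφ', hψ',
          by rw [hM''I]; exact hM'⟩

/-- **TERMINATION ⇒ ORDER REDUCTION (MODE 0, ISOLATED regime; root form over `𝔸⁵_K`).** `K = K̄` of characteristic
`p`, `F ≠ 0` clean with `p ≤ ord₀ F`, the origin the ONLY closed order-`p` point of `(z^p + F)·𝒪`. If the point-centre
walk below `(F, 0, ∅)` is well-founded (`Acc`: every chain of edges is finite) and along every admissible blow-up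
sequence of `M₀ = (𝔸⁵_K, (z^p + F)·𝒪, [], p)` the closed points of order `≥ p` are FINITELY MANY, then `M₀` admits a
marked resolution: the conclusion of `PIDim4.OrderReduction p` for this `F`. NOT `OrderReduction p`.
[cite: BierstoneGrigorievMilmanWlodarczyk2011, Def. 3.1.3] [cite: Hironaka1964, Main Theorem I (the characteristic-zero
statement whose analogue is asked)] -/
theorem exists_isMarkedResolution_of_acc_of_finite [IsAlgClosed K] [DecidableEq K] (F : MvPolynomial (Fin 4) K)
    (hF : F ≠ 0) (hclean : Literature.Barriers.ResolutionOfSingularities.HauserPerlega.IsClean p F)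
    (hperm : (p : ℕ∞) ≤ CentreBlowup.ordAlong (Finset.univ : Finset (Fin 4)) F)
    (hiso₀ : ∀ z : P 4 K, IsClosed ({z} : Set (P 4 K)) → (p : ℕ∞) ≤ idealOrder (hypSheaf p F) z → z = ξ 4 K)
    (hacc : Acc (fun s' s : State K => Edge p Finset.univ s s') (⟨F, 0, ∅⟩ : State K))
    (hfin : ∀ (X' : Scheme.{0}) (σ : X' ⟶ P 4 K) (M' : MarkedIdeal X'),
      IsMultipleBlowup (⟨hypSheaf p F, [], p⟩ : MarkedIdeal (P 4 K)) σ M' →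
      {w : X' | IsClosed ({w} : Set X') ∧ (p : ℕ∞) ≤ idealOrder M'.ideal w}.Finite) :
    ∃ (X' : Scheme.{0}) (π : X' ⟶ P 4 K) (M' : MarkedIdeal X'),
      IsMarkedResolution (⟨hypSheaf p F, [], p⟩ : MarkedIdeal (P 4 K)) π M' := by
  classical
  set M₀ : MarkedIdeal (P 4 K) := ⟨hypSheaf p F, [], p⟩ with hM₀
  set s₀ : State K := ⟨F, 0, ∅⟩ with hs₀
  have hE₀ : HasSNC M₀.boundary :=
    hasSNC_nil_of_isRegular (Literature.AlgebraicGeometry.Hironaka2017.Lib.AffinePointBlowupLSB.isRegular_Z 4 K)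
  -- the hydra relation is irreflexive; the root multiset `{s₀}` is accessible
  haveI : Std.Irrefl (fun s' s : State K => Edge p Finset.univ s s' ∧ s' ≠ s) := ⟨fun s hs => hs.2 rfl⟩
  have hacc' : Acc (fun s' s : State K => Edge p Finset.univ s s' ∧ s' ≠ s) s₀ :=
    Subrelation.accessible (fun hs => hs.1) hacc
  have hT : Acc (Relation.CutExpand (fun s' s : State K => Edge p Finset.univ s s' ∧ s' ≠ s))
      (({ξ 4 K} : Finset (P 4 K)).val.map fun _ => s₀) := by
    rw [Finset.singleton_val, Multiset.map_singleton]
    exact hacc'.cutExpand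
  refine exists_isMarkedResolution_of_config M₀ hE₀ rfl hfin _ hT (P 4 K) (𝟙 _) M₀ (IsMultipleBlowup.refl _)
    {ξ 4 K} (fun _ => s₀) rfl (fun x hx => ?_) (fun z hz hzo => ?_) (fun x hx => ?_)
  · rw [Finset.mem_singleton] at hx
    rw [hx]
    exact AffinePointBlowup.isClosed_ξ 4 K
  · rw [Finset.mem_singleton]
    exact hiso₀ z hz hzo
  · rw [Finset.mem_singleton] at hx
    subst hx
    exact ⟨hF, hclean, hperm, hacc, P 4 K, 𝟙 _, 𝟙 _, inferInstance, inferInstance, ξ 4 K, rfl, rfl, rfl⟩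

end Tree

end Equimultiple

end Summit.ResolutionOfSingularities.ResolutionOfSingularities.Theorems.PIDim4

end
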